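import Literature.NumberTheory.LFunctions.SuzukiScrewLineRepairedExpansion
import Literature.NumberTheory.LFunctions.SuzukiScrewLineProp31Proofs
import Literature.NumberTheory.LFunctions.SuzukiScrewLineProp41Proofs
import Literature.NumberTheory.LFunctions.ZetaScrewSeriesProofs
import Mathlib.MeasureTheory.Function.ConvergenceInMeasure
import HarnessLib

/-!
# CJM Thm 4.2 (repaired) and Cor 4.3: the screw line `𝔖ᴿ_t` of `ζ` under RH — discharge of `Suzuki2025_thm42R`, `Suzuki2025_cor43`

LINE 1 — LABEL: RH-CONSEQUENCE proof (explicit binder `RiemannHypothesis →`, never dropped) of the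
printed «Assume the RH is true» statement CJM Thm 4.2 over the REPAIRED screw line of the cell
(erratum E21, `SuzukiScrewLineRepaired.lean`), and the RH-EQUIVALENT·PRINTED criterion CJM Cor 4.3
PROVED AS AN EQUIVALENCE (neither side asserted). bears_on: B-C/B-P (LADDER-RH COLUMN 6 DBR).
WHAT THIS IS NOT: discharging a criterion paper's printed RH-consequence / RH-equivalence fixes the
kernel status of its named facts and WHICH identity (`(1/2π)‖𝔖_t‖² = Ψ(t)` for `t ≥ t₀`) would prove RH
through this door; it does not move RH; nothing here bears on the truth of RH.

Source: M. Suzuki, *On the Hilbert space derived from the Weil distribution*, Canad. J. Math. 2025 =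
arXiv:2301.00421v3 [Suzuki2025WeilHilbertSpace], §4.2 (TeX l.1182–1268); (4.9) = M. Suzuki, J. Lond.
Math. Soc. 2023 [Suzuki2023], (1.9).

## The printed proof (TeX l.1196–1240) and its transcription

"Assume RH. By (3.6) `𝔖_t = Σ_γ √(π m_γ)·(e^{−iγt} − 1)/γ · F_γ` with `Σ_γ m_γ|e^{−iγt} − 1|²/γ² < ∞`,
and `{F_γ}` is an orthonormal basis of `𝒦(Θ)` (Prop 4.1); hence
`(1/π)⟨𝔖_t, 𝔖_u⟩ = Σ_γ m_γ (e^{iγt} − 1)(e^{−iγu} − 1)/γ² = G_g(t,u)` by (4.9); with `𝔖_0 = 0` this is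
the screw-line property." Over the tree:
* (3.6)/(3.2) pointwise on `ℝ` for EVERY real `t` (the repaired object): CJM Prop 3.1, now the tree
  theorem `Suzuki2025_prop31_holds`, through `screwPR_eq_screwZeroExpansionR_of_prop31`
  (`conj_screwLineR_ofReal_eq_tsum`; the conjugate is expanded because `F_γ` carries `1 + Θ` while
  `𝔖_t` carries `1 + Θ♯`, and `Θ♯ = conj Θ` on `ℝ`);
* orthonormality of the classes `[F_γ|_ℝ]` under RH: `Suzuki2025_prop41_holds` (only orthonormality is
  used, not completeness);
* the `ℓ²` coefficients give an `L²(ℝ)`-convergent orthonormal expansion whose sum IS the class of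
  `conj 𝔖ᴿ_t` (`L²`-convergence ⇒ a.e. convergence along a subsequence of partial sums,
  `exists_hasSum_coeff_smul_toLp`), so `⟨𝔖ᴿ_t, 𝔖ᴿ_u⟩` is the `ℓ²` pairing of the coefficients
  (`hasSum_conj_mul_inner_of_hasSum_smul`);
* (4.9) `G_g(t,u) = Σ_γ m_γ(e^{−iγt} − 1)(e^{iγu} − 1)/γ²` is proved RH-FREE (`hasSum_zetaScrewKernel`) from
  `Ψ(t) = Σ_ρ m_ρ(cosh((ρ−½)t) − 1)/(ρ−½)²` (`Suzuki2023_thm11_series_holds`) by the symmetrisation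
  `ρ ↦ 1 − ρ` of the zero set;
* the Kreĭn–Langer property and the continuity of `t ↦ π^{−1/2}[𝔖ᴿ_t]` follow from (4.4)ᴿ and
  `G_g(t,u) = g(t−u) − g(t) − g(−u) + g(0)` (`zetaScrewKernel`, `continuous_zetaScrew`).
Deviation from print: none in substance; `𝔖_0 ≡ 0` is not needed separately since (4.4)ᴿ is proved for
all real `t, u` directly. No definition and no named fact is introduced.

## Main results
* `ScrewLineThm42.hasSum_zetaScrewKernel` — (4.9), RH-FREE.
* `ScrewLineThm42.integral_screwLineR_mul_conj` — (4.4)ᴿ under RH.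
* `Suzuki2025_thm42R_holds : Suzuki2025_thm42R`, `Suzuki2025_cor43_holds : Suzuki2025_cor43`.

## References
* [Suzuki2025WeilHilbertSpace] M. Suzuki, Canad. J. Math. 2025 = arXiv:2301.00421v3, Thm 4.2 and its
  proof (TeX l.1182–1240), Cor 4.3 (l.1250–1268), (3.2)/(3.6) (l.768–781, l.1026–1032), Prop 4.1
  (l.1120–1141).
* [Suzuki2023] M. Suzuki, J. Lond. Math. Soc. 108 (2023), Thm 1.1 (2) and eq. (1.9).
-/

noncomputable section

open MeasureTheory Complex Filter Set Real
open Literature.Analysis.DeBrangesSpaces (sharp sharp_apply sharp_ofReal)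
open scoped ComplexConjugate Topology InnerProductSpace ENNReal

namespace Literature.NumberTheory.LFunctions

open ZetaZeros ScrewLineRepairedExpansion

namespace ScrewLineThm42


/-- **`Σ_ρ m_ρ/‖γ_ρ‖² < ∞`** (`‖γ_ρ‖ ≥ |Im ρ|`; majorant `2m_ρ/(1 + Im ρ²)` off the finite set
`|Im ρ| ≤ 1`). RH-FREE. [cite: Suzuki2025WeilHilbertSpace, §3.1 (TeX l.776–781, "Σ m_γ|γ|^{−1−δ} < ∞")] -/
theorem summable_zeroOrder_div_norm_zeroParam_sq :
    Summable fun ρ : riemannZetaNontrivialZeros ↦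
      (riemannZetaZeroOrder (ρ : ℂ) : ℝ) / ‖suzukiZeroParam (ρ : ℂ)‖ ^ 2 := by
  refine Summable.of_norm_bounded_eventually
    ((ZetaZeroSum.summable_zeroOrder_div_one_add_sq).mul_left 2) ?_
  filter_upwards [(weilZeroFinset 1).eventually_cofinite_notMem] with ρ hρ
  rw [mem_weilZeroFinset, not_le] at hρ
  have hm0 : (0 : ℝ) ≤ riemannZetaZeroOrder (ρ : ℂ) := ZetaZeroSum.zeroOrder_nonneg ρ
  have hγ := abs_im_le_norm_zeroParam (ρ : ℂ)
  have him : (ρ : ℂ).im ^ 2 = |(ρ : ℂ).im| ^ 2 := (sq_abs _).symm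
  have h1 : 1 + (ρ : ℂ).im ^ 2 ≤ 2 * ‖suzukiZeroParam (ρ : ℂ)‖ ^ 2 := by
    rw [him]
    nlinarith [abs_nonneg ((ρ : ℂ).im), hγ]
  have hpos : 0 < 1 + (ρ : ℂ).im ^ 2 := by positivity
  rw [Real.norm_of_nonneg (div_nonneg hm0 (sq_nonneg _))]
  calc (riemannZetaZeroOrder (ρ : ℂ) : ℝ) / ‖suzukiZeroParam (ρ : ℂ)‖ ^ 2
      ≤ (riemannZetaZeroOrder (ρ : ℂ) : ℝ) / ((1 + (ρ : ℂ).im ^ 2) / 2) :=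
        div_le_div_of_nonneg_left hm0 (by positivity) (by linarith)
    _ = 2 * ((riemannZetaZeroOrder (ρ : ℂ) : ℝ) / (1 + (ρ : ℂ).im ^ 2)) := by
        field_simp

/-- `‖e^{±iγ_ρ s} − 1‖ ≤ e^{|s|/2} + 1` (`Re(±iγ_ρ) = ∓(Re ρ − ½) ∈ [−½, ½]`). RH-FREE.
[cite: Suzuki2025WeilHilbertSpace, §3.1 (TeX l.776–781)] -/
theorem norm_cexp_neg_I_zeroParam_sub_one_le (ρ : riemannZetaNontrivialZeros) (s : ℝ) :
    ‖cexp (-(I * suzukiZeroParam (ρ : ℂ) * s)) - 1‖ ≤ Real.exp (|s| / 2) + 1 := by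
  obtain ⟨-, h0, h1⟩ := mem_riemannZetaNontrivialZeros_iff_holds.1 ρ.2
  have e : -(I * suzukiZeroParam (ρ : ℂ) * s) = (-(I * suzukiZeroParam (ρ : ℂ))) * (s : ℂ) := by ring
  rw [e]
  refine norm_cexp_mul_sub_one_le ?_ s
  have : (-(I * suzukiZeroParam (ρ : ℂ))).re = (ρ : ℂ).re - 1 / 2 := by
    simp [suzukiZeroParam]
  rw [this]; exact abs_le.2 ⟨by linarith, by linarith⟩

/-- Companion bound `‖e^{iγ_ρ s} − 1‖ ≤ e^{|s|/2} + 1`. RH-FREE. [cite: Suzuki2025WeilHilbertSpace, §3.1 (TeX l.776–781)] -/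
theorem norm_cexp_I_zeroParam_sub_one_le (ρ : riemannZetaNontrivialZeros) (s : ℝ) :
    ‖cexp (I * suzukiZeroParam (ρ : ℂ) * s) - 1‖ ≤ Real.exp (|s| / 2) + 1 := by
  obtain ⟨-, h0, h1⟩ := mem_riemannZetaNontrivialZeros_iff_holds.1 ρ.2
  refine norm_cexp_mul_sub_one_le ?_ s
  have : (I * suzukiZeroParam (ρ : ℂ)).re = 1 / 2 - (ρ : ℂ).re := by
    simp [suzukiZeroParam]
  rw [this]; exact abs_le.2 ⟨by linarith, by linarith⟩

/-- `γ_ρ ≠ 0` for a non-trivial zero. RH-FREE. [cite: Suzuki2025WeilHilbertSpace, eq. (1.1)] -/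
theorem zeroParam_ne_zero (ρ : riemannZetaNontrivialZeros) : suzukiZeroParam (ρ : ℂ) ≠ 0 :=
  norm_pos_iff.1 (norm_zeroParam_pos ρ)

/-- **(4.9), RH-FREE form: `G_g(t,u) = Σ_ρ m_ρ (e^{−iγ_ρ t} − 1)(e^{iγ_ρ u} − 1)/γ_ρ²`** for all real
`t, u` — Suzuki JLMS 2023 (1.9) (printed under RH with real `γ`), obtained unconditionally from
`Ψ(t) = Σ_ρ m_ρ (cosh((ρ−½)t) − 1)/(ρ−½)²` (`Suzuki2023_thm11_series_holds`) by the symmetrisation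
`ρ ↦ 1 − ρ` (`γ ↦ −γ`) of the zero set: the symmetrised summand is
`2m_ρ[(cosh γ̃t − 1) + (cosh γ̃u − 1) − (cosh γ̃(t−u) − 1)]/γ̃²`, `γ̃ = ρ − ½ = −iγ_ρ`.
[cite: Suzuki2025WeilHilbertSpace, eq. (4.9) (TeX l.1226–1231); Suzuki2023, eq. (1.9)] -/
theorem hasSum_zetaScrewKernel (t u : ℝ) :
    HasSum (fun ρ : riemannZetaNontrivialZeros ↦ (riemannZetaZeroOrder (ρ : ℂ) : ℂ) *
      ((cexp (-(I * suzukiZeroParam (ρ : ℂ) * t)) - 1) * (cexp (I * suzukiZeroParam (ρ : ℂ) * u) - 1) /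
        suzukiZeroParam (ρ : ℂ) ^ 2)) (zetaScrewKernel t u : ℂ) := by
  set f : riemannZetaNontrivialZeros → ℂ := fun ρ ↦ (riemannZetaZeroOrder (ρ : ℂ) : ℂ) *
      ((cexp (-(I * suzukiZeroParam (ρ : ℂ) * t)) - 1) * (cexp (I * suzukiZeroParam (ρ : ℂ) * u) - 1) /
        suzukiZeroParam (ρ : ℂ) ^ 2) with hf
  -- summability from `Σ m/‖γ‖² < ∞`
  have hsf : Summable f := by
    refine Summable.of_norm_bounded
      (summable_zeroOrder_div_norm_zeroParam_sq.mul_left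
        ((Real.exp (|t| / 2) + 1) * (Real.exp (|u| / 2) + 1))) fun ρ ↦ ?_
    have hm0 : (0 : ℝ) ≤ riemannZetaZeroOrder (ρ : ℂ) := ZetaZeroSum.zeroOrder_nonneg ρ
    rw [hf]
    simp only
    rw [norm_mul, norm_div, norm_mul, norm_pow, Complex.norm_intCast, abs_of_nonneg hm0]
    have hA := norm_cexp_neg_I_zeroParam_sub_one_le ρ t
    have hB := norm_cexp_I_zeroParam_sub_one_le ρ u
    have hγ : 0 < ‖suzukiZeroParam (ρ : ℂ)‖ := norm_zeroParam_pos ρ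
    have hAB : ‖cexp (-(I * suzukiZeroParam (ρ : ℂ) * t)) - 1‖ * ‖cexp (I * suzukiZeroParam (ρ : ℂ) * u) - 1‖ ≤
        (Real.exp (|t| / 2) + 1) * (Real.exp (|u| / 2) + 1) :=
      mul_le_mul hA hB (norm_nonneg _) (by positivity)
    have hq : 0 ≤ (riemannZetaZeroOrder (ρ : ℂ) : ℝ) / ‖suzukiZeroParam (ρ : ℂ)‖ ^ 2 := by positivity
    calc (riemannZetaZeroOrder (ρ : ℂ) : ℝ) * (‖cexp (-(I * suzukiZeroParam (ρ : ℂ) * t)) - 1‖ *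
          ‖cexp (I * suzukiZeroParam (ρ : ℂ) * u) - 1‖ / ‖suzukiZeroParam (ρ : ℂ)‖ ^ 2)
        = (riemannZetaZeroOrder (ρ : ℂ) : ℝ) / ‖suzukiZeroParam (ρ : ℂ)‖ ^ 2 *
            (‖cexp (-(I * suzukiZeroParam (ρ : ℂ) * t)) - 1‖ * ‖cexp (I * suzukiZeroParam (ρ : ℂ) * u) - 1‖) := by
          ring
      _ ≤ (riemannZetaZeroOrder (ρ : ℂ) : ℝ) / ‖suzukiZeroParam (ρ : ℂ)‖ ^ 2 *
            ((Real.exp (|t| / 2) + 1) * (Real.exp (|u| / 2) + 1)) := by gcongr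
      _ = (Real.exp (|t| / 2) + 1) * (Real.exp (|u| / 2) + 1) *
            ((riemannZetaZeroOrder (ρ : ℂ) : ℝ) / ‖suzukiZeroParam (ρ : ℂ)‖ ^ 2) := mul_comm _ _
  obtain ⟨S, hS⟩ := hsf
  -- the involution `ρ ↦ 1 − ρ`
  have hinv : Function.Involutive (fun ρ : riemannZetaNontrivialZeros ↦
      (⟨1 - (ρ : ℂ), oneSub_mem ρ⟩ : riemannZetaNontrivialZeros)) := by
    intro ρ; ext; simp
  set σ : Equiv.Perm riemannZetaNontrivialZeros := hinv.toPerm _ with hσ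
  have hSσ : HasSum (f ∘ σ) S := (Equiv.hasSum_iff σ).2 hS
  have hsum2 : HasSum (fun ρ ↦ f ρ + f (σ ρ)) (S + S) := hS.add hSσ
  -- the symmetrised summand is twice the `Ψ`-series summand at `t`, `u`, minus that at `t − u`
  set g : ℝ → riemannZetaNontrivialZeros → ℂ := fun s ρ ↦ (riemannZetaZeroOrder (ρ : ℂ) : ℂ) *
      ((Complex.cosh (((ρ : ℂ) - 1 / 2) * s) - 1) / ((ρ : ℂ) - 1 / 2) ^ 2) with hg
  have hΨ : ∀ s : ℝ, HasSum (g s) (zetaScrew s : ℂ) := fun s ↦ Suzuki2023_thm11_series_holds s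
  have hG : HasSum (fun ρ ↦ 2 * (g t ρ + g u ρ - g (t - u) ρ)) (2 * (zetaScrewKernel t u : ℂ)) := by
    have := ((hΨ t).add (hΨ u)).sub (hΨ (t - u))
    rw [zetaScrewKernel]
    push_cast
    exact this.mul_left 2
  have hpt : ∀ ρ : riemannZetaNontrivialZeros, f ρ + f (σ ρ) = 2 * (g t ρ + g u ρ - g (t - u) ρ) := by
    intro ρ
    have hγσ : suzukiZeroParam ((σ ρ : riemannZetaNontrivialZeros) : ℂ) = -suzukiZeroParam (ρ : ℂ) := by
      rw [hσ]; simp only [Function.Involutive.coe_toPerm]; exact suzukiZeroParam_one_sub _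
    have hmσ : (riemannZetaZeroOrder ((σ ρ : riemannZetaNontrivialZeros) : ℂ) : ℂ) =
        riemannZetaZeroOrder (ρ : ℂ) := by
      rw [hσ]; simp only [Function.Involutive.coe_toPerm]
      exact_mod_cast riemannZetaZeroOrder_one_sub_of_mem ρ.2
    simp only [hf, hg, hγσ, hmσ]
    set a : ℂ := (ρ : ℂ) - 1 / 2 with ha
    have hγa : suzukiZeroParam (ρ : ℂ) = I * a := rfl
    have ha0 : a ≠ 0 := by
      intro h
      have := riemannZetaNontrivialZeros.im_ne_zero ρ.2
      apply this
      have h' := congrArg Complex.im h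
      simpa [ha] using h'
    rw [hγa]
    have e1 : -(I * (I * a) * (t : ℂ)) = a * t := by linear_combination (-(a * t)) * Complex.I_sq
    have e2 : I * (I * a) * (u : ℂ) = -(a * u) := by linear_combination (a * u) * Complex.I_sq
    have e3 : -(I * -(I * a) * (t : ℂ)) = -(a * t) := by linear_combination (a * t) * Complex.I_sq
    have e4 : I * -(I * a) * (u : ℂ) = a * u := by linear_combination (-(a * u)) * Complex.I_sq
    have e5 : (I * a) ^ 2 = -a ^ 2 := by linear_combination a ^ 2 * Complex.I_sq
    have e6 : (-(I * a)) ^ 2 = -a ^ 2 := by linear_combination a ^ 2 * Complex.I_sq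
    rw [e1, e2, e3, e4, e5, e6]
    simp only [Complex.cosh]
    have hsub : a * ((t - u : ℝ) : ℂ) = a * t - a * u := by push_cast; ring
    rw [hsub, Complex.exp_sub, show -(a * ↑t - a * ↑u) = a * u - a * t by ring, Complex.exp_sub,
      Complex.exp_neg, Complex.exp_neg]
    have hA : cexp (a * t) ≠ 0 := Complex.exp_ne_zero _
    have hB : cexp (a * u) ≠ 0 := Complex.exp_ne_zero _
    field_simp
    ring
  have hsum2' : HasSum (fun ρ ↦ f ρ + f (σ ρ)) (2 * (zetaScrewKernel t u : ℂ)) := by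
    convert hG using 1
    funext ρ; exact hpt ρ
  have hSS : S + S = 2 * (zetaScrewKernel t u : ℂ) := hsum2.unique hsum2'
  have hSeq : S = (zetaScrewKernel t u : ℂ) := by linear_combination hSS / 2
  rwa [hSeq] at hS


/-! ## B. The conjugated repaired screw line as a zero sum on the real line (RH-FREE) -/

/-- The conjugated term of the all-`t` zero expansion (3.2):
`conj[m (e^{−iγt} − 1)/γ · 1/(x − γ)] = m (e^{iγ̄t} − 1)/γ̄ · 1/(x − γ̄)` for real `t`, `x`.
[cite: Suzuki2025WeilHilbertSpace, (3.2)/(3.6) (TeX l.768–781, l.1026–1032); erratum E21] -/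
theorem conj_zeroTermR (ρ : riemannZetaNontrivialZeros) (t x : ℝ) :
    conj ((riemannZetaZeroOrder (ρ : ℂ) : ℂ) *
        ((cexp (-(I * suzukiZeroParam (ρ : ℂ) * t)) - 1) / suzukiZeroParam (ρ : ℂ)) *
        (1 / ((x : ℂ) - suzukiZeroParam (ρ : ℂ)))) =
      (riemannZetaZeroOrder (ρ : ℂ) : ℂ) *
        ((cexp (I * conj (suzukiZeroParam (ρ : ℂ)) * t) - 1) / conj (suzukiZeroParam (ρ : ℂ))) *
        (1 / ((x : ℂ) - conj (suzukiZeroParam (ρ : ℂ)))) := by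
  simp only [map_mul, map_div₀, map_sub, map_one, Complex.conj_ofReal, map_intCast,
    ← Complex.exp_conj, map_neg, Complex.conj_I]
  ring_nf

/-- **(3.6) for the repaired screw line, conjugated, for EVERY real `t`** (RH-FREE; CJM Prop 3.1 is the
tree theorem `Suzuki2025_prop31_holds`): for real `x ≠ 0` off `Γ`,
`conj 𝔖ᴿ_t(x) = −(i/2)(1 + Θ(x)) · Σ_ρ m_ρ (e^{iγ̄_ρ t} − 1)/γ̄_ρ · 1/(x − γ̄_ρ)`.
[cite: Suzuki2025WeilHilbertSpace, (3.6) (TeX l.1026–1032) with Prop. 3.1 (l.789–793); erratum E21] -/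
theorem conj_screwLineR_ofReal_eq_tsum (t : ℝ) {x : ℝ} (hx0 : x ≠ 0)
    (hxΓ : ∀ ρ ∈ riemannZetaNontrivialZeros, (x : ℂ) ≠ suzukiZeroParam ρ) :
    conj (screwLineR t x) = -(I / 2) * (1 + lagariasTheta x) *
      ∑' ρ : riemannZetaNontrivialZeros, (riemannZetaZeroOrder (ρ : ℂ) : ℂ) *
        ((cexp (I * conj (suzukiZeroParam (ρ : ℂ)) * t) - 1) / conj (suzukiZeroParam (ρ : ℂ))) *
        (1 / ((x : ℂ) - conj (suzukiZeroParam (ρ : ℂ)))) := by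
  have hP : screwPR t x = screwZeroExpansionR t x := by
    refine screwPR_eq_screwZeroExpansionR_of_prop31 Suzuki2025_prop31_holds t
      (by exact_mod_cast hx0) (fun h ↦ ?_) (fun h ↦ ?_) (fun n h ↦ ?_) (fun n h ↦ ?_) hxΓ
    · have := congrArg Complex.im h; simp at this
    · have := congrArg Complex.im h; simp at this
    · have := congrArg Complex.im h; simp at this; linarith [n.cast_nonneg (α := ℝ)]
    · have := congrArg Complex.im h; simp at this; linarith [n.cast_nonneg (α := ℝ)]
  rw [screwLineR, hP, screwZeroExpansionR, map_mul, Complex.conj_tsum]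
  simp only [conj_zeroTermR]
  congr 1
  rw [map_div₀, map_mul, Complex.conj_I, map_add, map_one, sharp_ofReal, Complex.conj_conj]
  simp only [map_ofNat]
  ring

/-! ## C. Under RH: the `L²` orthonormal expansion of `conj 𝔖ᴿ_t` in the family `[F_γ]` -/

/-- The coefficients `b_ρ(t) = −√(π m_ρ)(e^{iγ_ρ t} − 1)/γ_ρ` of (3.6) are square-summable:
`Σ_ρ |b_ρ(t)|² ≤ π(e^{|t|/2} + 1)² Σ_ρ m_ρ/|γ_ρ|² < ∞` (RH-FREE; under RH `|e^{iγt}| = 1` as printed).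
[cite: Suzuki2025WeilHilbertSpace, proof of Thm 4.2 (TeX l.1203–1207, "Σ m_γ|e^{−iγt}−1|²/γ² < ∞")] -/
theorem summable_norm_sq_coeff (t : ℝ) :
    Summable fun ρ : riemannZetaNontrivialZeros ↦
      ‖-((Real.sqrt ((riemannZetaZeroOrder (ρ : ℂ) : ℝ) * Real.pi) : ℝ) : ℂ) *
        (cexp (I * suzukiZeroParam (ρ : ℂ) * t) - 1) / suzukiZeroParam (ρ : ℂ)‖ ^ 2 := by
  refine Summable.of_nonneg_of_le (fun _ ↦ sq_nonneg _) (fun ρ ↦ ?_)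
    (summable_zeroOrder_div_norm_zeroParam_sq.mul_left (Real.pi * (Real.exp (|t| / 2) + 1) ^ 2))
  have hm0 : (0 : ℝ) ≤ riemannZetaZeroOrder (ρ : ℂ) := ZetaZeroSum.zeroOrder_nonneg ρ
  have hA := norm_cexp_I_zeroParam_sub_one_le ρ t
  have hγ := norm_zeroParam_pos ρ
  rw [norm_div, norm_mul, norm_neg, Complex.norm_real, Real.norm_of_nonneg (Real.sqrt_nonneg _),
    div_pow, mul_pow, Real.sq_sqrt (by positivity)]
  calc (riemannZetaZeroOrder (ρ : ℂ) : ℝ) * Real.pi * ‖cexp (I * suzukiZeroParam (ρ : ℂ) * t) - 1‖ ^ 2 /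
        ‖suzukiZeroParam (ρ : ℂ)‖ ^ 2
      = Real.pi * ‖cexp (I * suzukiZeroParam (ρ : ℂ) * t) - 1‖ ^ 2 *
          ((riemannZetaZeroOrder (ρ : ℂ) : ℝ) / ‖suzukiZeroParam (ρ : ℂ)‖ ^ 2) := by ring
    _ ≤ Real.pi * (Real.exp (|t| / 2) + 1) ^ 2 *
          ((riemannZetaZeroOrder (ρ : ℂ) : ℝ) / ‖suzukiZeroParam (ρ : ℂ)‖ ^ 2) := by
        gcongr

/-- `√(m π) · √(m/π) = m`. [folklore] -/
private theorem sqrt_mul_sqrt_div (m : ℝ) (hm : 0 ≤ m) :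
    Real.sqrt (m * Real.pi) * Real.sqrt (m / Real.pi) = m := by
  rw [← Real.sqrt_mul (by positivity), show m * Real.pi * (m / Real.pi) = m * m by
    field_simp, Real.sqrt_mul_self hm]

/-- **The pointwise expansion `conj 𝔖ᴿ_t(x) = Σ_ρ b_ρ(t) F_ρ(x)` under RH** (all `γ_ρ` real, so
`γ̄_ρ = γ_ρ` in `conj_screwLineR_ofReal_eq_tsum` and the `ρ`-th term is `b_ρ(t)F_ρ(x)` with
`F_ρ = screwBasis ρ` of (3.5), `b_ρ(t) = −√(π m_ρ)(e^{iγ_ρ t} − 1)/γ_ρ`), as an absolutely convergent sum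
at every real `x ≠ 0` off `Γ`. RH-CONSEQUENCE. [cite: Suzuki2025WeilHilbertSpace, (3.6) (TeX l.1026–1032) and proof of Thm 4.2 (l.1196–1207)] -/
theorem hasSum_coeff_mul_screwBasis (hRH : RiemannHypothesis) (t : ℝ) {x : ℝ} (hx0 : x ≠ 0)
    (hxΓ : ∀ ρ ∈ riemannZetaNontrivialZeros, (x : ℂ) ≠ suzukiZeroParam ρ) :
    HasSum (fun ρ : riemannZetaNontrivialZeros ↦
      (-((Real.sqrt ((riemannZetaZeroOrder (ρ : ℂ) : ℝ) * Real.pi) : ℝ) : ℂ) *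
        (cexp (I * suzukiZeroParam (ρ : ℂ) * t) - 1) / suzukiZeroParam (ρ : ℂ)) * screwBasis ρ x)
      (conj (screwLineR t x)) := by
  have hreal : ∀ ρ : riemannZetaNontrivialZeros, conj (suzukiZeroParam (ρ : ℂ)) = suzukiZeroParam (ρ : ℂ) :=
    fun ρ ↦ Complex.conj_eq_iff_im.2 (suzukiZeroParam_im_eq_zero hRH ρ.2)
  set K : ℂ := -(I / 2) * (1 + lagariasTheta x) with hK
  set g : riemannZetaNontrivialZeros → ℂ := fun ρ ↦ (riemannZetaZeroOrder (ρ : ℂ) : ℂ) *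
      ((cexp (I * conj (suzukiZeroParam (ρ : ℂ)) * t) - 1) / conj (suzukiZeroParam (ρ : ℂ))) *
      (1 / ((x : ℂ) - conj (suzukiZeroParam (ρ : ℂ)))) with hg
  -- summability of the zero series at `x`
  have hgs : Summable fun ρ ↦ K * g ρ := by
    refine Summable.of_norm_bounded ((summable_norm_coeff K x).mul_left (Real.exp (|t| / 2) + 1))
      fun ρ ↦ ?_
    have hm0 : (0 : ℝ) ≤ riemannZetaZeroOrder (ρ : ℂ) := ZetaZeroSum.zeroOrder_nonneg ρ
    have hA : ‖cexp (I * conj (suzukiZeroParam (ρ : ℂ)) * t) - 1‖ ≤ Real.exp (|t| / 2) + 1 :=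
      norm_cexp_conj_zeroParam_sub_one_le ρ t
    have hfac : K * g ρ = K * ((riemannZetaZeroOrder (ρ : ℂ) : ℂ) /
        (conj (suzukiZeroParam (ρ : ℂ)) * ((x : ℂ) - conj (suzukiZeroParam (ρ : ℂ))))) *
        (cexp (I * conj (suzukiZeroParam (ρ : ℂ)) * t) - 1) := by
      simp only [hg, div_eq_mul_inv, mul_inv, one_mul]
      ring
    rw [hfac, norm_mul, mul_comm]
    exact mul_le_mul_of_nonneg_right hA (norm_nonneg _)
  have hsum : HasSum (fun ρ ↦ K * g ρ) (conj (screwLineR t x)) := by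
    rw [conj_screwLineR_ofReal_eq_tsum t hx0 hxΓ, ← hK, ← tsum_mul_left]
    exact hgs.hasSum
  -- termwise identification with `b_ρ(t) F_ρ(x)`
  refine (hsum.congr_fun fun ρ ↦ ?_)
  have hm0 : (0 : ℝ) ≤ riemannZetaZeroOrder (ρ : ℂ) := ZetaZeroSum.zeroOrder_nonneg ρ
  have hγ0 : suzukiZeroParam (ρ : ℂ) ≠ 0 := zeroParam_ne_zero ρ
  have hxγ : (x : ℂ) - suzukiZeroParam (ρ : ℂ) ≠ 0 := sub_ne_zero.2 (hxΓ ρ ρ.2)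
  have hsq : ((Real.sqrt ((riemannZetaZeroOrder (ρ : ℂ) : ℝ) * Real.pi) : ℝ) : ℂ) *
      ((Real.sqrt ((riemannZetaZeroOrder (ρ : ℂ) : ℝ) / Real.pi) : ℝ) : ℂ) =
        (riemannZetaZeroOrder (ρ : ℂ) : ℂ) := by
    rw [← Complex.ofReal_mul, sqrt_mul_sqrt_div _ hm0]
    norm_cast
  show _ = K * g ρ
  simp only [hg, hK, hreal ρ, screwBasis]
  rw [← hsq]
  simp only [div_eq_mul_inv, mul_inv, one_mul]
  ring

/-- Almost-everywhere form of a finite sum in `L²`. [folklore] -/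
private theorem coeFn_finset_sum {ι : Type*} (s : Finset ι) (f : ι → Lp ℂ 2 (volume : Measure ℝ)) :
    ⇑(∑ j ∈ s, f j) =ᵐ[volume] fun x ↦ ∑ j ∈ s, (f j : ℝ → ℂ) x := by
  classical
  induction s using Finset.induction_on with
  | empty =>
    simp only [Finset.sum_empty]
    exact Lp.coeFn_zero ℂ 2 (volume : Measure ℝ)
  | insert a s ha ih =>
    rw [Finset.sum_insert ha]
    filter_upwards [Lp.coeFn_add (f a) (∑ j ∈ s, f j), ih] with x hx hx'
    rw [hx, Pi.add_apply, hx', Finset.sum_insert ha]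

/-- `conj 𝔖ᴿ_t ∈ L²(ℝ)` (Prop 1.2ᴿ). [cite: Suzuki2025WeilHilbertSpace, Prop. 1.2 (TeX l.376–383); erratum E21] -/
theorem memLp_conj_screwLineR (t : ℝ) :
    MemLp (fun x : ℝ ↦ conj (screwLineR t x)) 2 volume :=
  MemLp.of_le (memLp_screwLineR t)
    (Complex.continuous_conj.comp_aestronglyMeasurable (memLp_screwLineR t).1)
    (Eventually.of_forall fun x ↦ by simp)

/-- **The `L²(ℝ)` expansion of `conj 𝔖ᴿ_t` under RH**: with `{[F_γ]}` orthonormal in `L²(ℝ)` (Prop 4.1)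
and the `ℓ²` coefficients `b_ρ(t)`, the orthonormal series `Σ_ρ b_ρ(t)·[F_ρ]` converges in `L²(ℝ)` to a
class whose representative is a.e. `conj 𝔖ᴿ_t` ("we have `𝔖_t ∈ 𝒦(Θ)` by Prop 4.1", TeX l.1207):
`L²`-convergence gives a.e. convergence along a subsequence of partial sums, which converge pointwise
to `conj 𝔖ᴿ_t(x)` by `hasSum_coeff_mul_screwBasis`. RH-CONSEQUENCE.
[cite: Suzuki2025WeilHilbertSpace, proof of Thm 4.2 (TeX l.1196–1207)] -/
theorem exists_hasSum_coeff_smul_toLp (hRH : RiemannHypothesis)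
    {hF : ∀ ρ : riemannZetaNontrivialZeros, MemLp (fun x : ℝ ↦ screwBasis ρ x) 2 volume}
    (hON : Orthonormal ℂ (fun ρ : riemannZetaNontrivialZeros ↦
      ((hF ρ).toLp _ : Lp ℂ 2 (volume : Measure ℝ)))) (t : ℝ) :
    ∃ C : Lp ℂ 2 (volume : Measure ℝ),
      HasSum (fun ρ : riemannZetaNontrivialZeros ↦
        (-((Real.sqrt ((riemannZetaZeroOrder (ρ : ℂ) : ℝ) * Real.pi) : ℝ) : ℂ) *
          (cexp (I * suzukiZeroParam (ρ : ℂ) * t) - 1) / suzukiZeroParam (ρ : ℂ)) •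
          ((hF ρ).toLp _ : Lp ℂ 2 (volume : Measure ℝ))) C ∧
      (C : ℝ → ℂ) =ᵐ[volume] fun x ↦ conj (screwLineR t x) := by
  classical
  haveI : Countable riemannZetaNontrivialZeros := riemannZetaNontrivialZeros_countable.to_subtype
  set e : riemannZetaNontrivialZeros → Lp ℂ 2 (volume : Measure ℝ) := fun ρ ↦ (hF ρ).toLp _ with he
  set b : riemannZetaNontrivialZeros → ℂ := fun ρ ↦
    -((Real.sqrt ((riemannZetaZeroOrder (ρ : ℂ) : ℝ) * Real.pi) : ℝ) : ℂ) *
      (cexp (I * suzukiZeroParam (ρ : ℂ) * t) - 1) / suzukiZeroParam (ρ : ℂ) with hb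
  have hsum : Summable fun ρ ↦ b ρ • e ρ :=
    (hON.orthogonalFamily.summable_iff_norm_sq_summable b).2 (summable_norm_sq_coeff t)
  refine ⟨∑' ρ, b ρ • e ρ, hsum.hasSum, ?_⟩
  set C : Lp ℂ 2 (volume : Measure ℝ) := ∑' ρ, b ρ • e ρ with hC
  have hCt : Tendsto (fun s : Finset riemannZetaNontrivialZeros ↦ ∑ ρ ∈ s, b ρ • e ρ) atTop (𝓝 C) :=
    hsum.hasSum
  -- `L²` convergence ⇒ a.e. convergence along a sequence of finite sets tending to `atTop`
  have hmeas : TendstoInMeasure volume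
      (fun s : Finset riemannZetaNontrivialZeros ↦ (⇑(∑ ρ ∈ s, b ρ • e ρ) : ℝ → ℂ)) atTop (⇑C) :=
    tendstoInMeasure_of_tendsto_Lp hCt
  obtain ⟨ns, hns, hae⟩ := hmeas.exists_seq_tendsto_ae'
  -- pointwise bookkeeping, a.e.
  have hE : ∀ᵐ x : ℝ, ∀ ρ : riemannZetaNontrivialZeros, (e ρ : ℝ → ℂ) x = screwBasis ρ x :=
    ae_all_iff.2 fun ρ ↦ MemLp.coeFn_toLp (hF ρ)
  have hS : ∀ᵐ x : ℝ, ∀ ρ : riemannZetaNontrivialZeros,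
      ((b ρ • e ρ : Lp ℂ 2 (volume : Measure ℝ)) : ℝ → ℂ) x = b ρ * (e ρ : ℝ → ℂ) x := by
    rw [ae_all_iff]
    intro ρ
    filter_upwards [Lp.coeFn_smul (b ρ) (e ρ)] with x hx
    rw [hx, Pi.smul_apply, smul_eq_mul]
  have hF' : ∀ᵐ x : ℝ, ∀ s : Finset riemannZetaNontrivialZeros,
      (⇑(∑ ρ ∈ s, b ρ • e ρ) : ℝ → ℂ) x = ∑ ρ ∈ s, ((b ρ • e ρ : Lp ℂ 2 (volume : Measure ℝ)) : ℝ → ℂ) x :=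
    ae_all_iff.2 fun s ↦ coeFn_finset_sum s _
  filter_upwards [hae, hE, hS, hF', ae_good_point] with x hx h1 h2 h3 ⟨hx0, _, hxΓ, _⟩
  have hpt := hasSum_coeff_mul_screwBasis hRH t hx0 hxΓ
  have hlim1 : Tendsto (fun i ↦ ∑ ρ ∈ ns i, b ρ * screwBasis ρ x) atTop
      (𝓝 (conj (screwLineR t x))) := hpt.comp hns
  have hlim2 : Tendsto (fun i ↦ ∑ ρ ∈ ns i, b ρ * screwBasis ρ x) atTop (𝓝 ((C : ℝ → ℂ) x)) := by
    refine hx.congr fun i ↦ ?_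
    rw [h3 (ns i)]
    exact Finset.sum_congr rfl fun ρ _ ↦ by rw [h2 ρ, h1 ρ]
  exact tendsto_nhds_unique hlim2 hlim1

/-- **`ℓ²` pairing of two orthonormal expansions**: if `A = Σ aᵢ eᵢ`, `C = Σ cᵢ eᵢ` for an orthonormal
family `(eᵢ)`, then `⟪A, C⟫ = Σ conj(aᵢ) cᵢ`. [folklore] -/
private theorem hasSum_conj_mul_inner_of_hasSum_smul {ι E : Type*} [NormedAddCommGroup E]
    [InnerProductSpace ℂ E] {e : ι → E} (hON : Orthonormal ℂ e) {a c : ι → ℂ} {A C : E}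
    (hA : HasSum (fun i ↦ a i • e i) A) (hC : HasSum (fun i ↦ c i • e i) C) :
    HasSum (fun i ↦ conj (a i) * c i) (inner ℂ A C) := by
  classical
  -- `⟪e i, A⟫ = a i`
  have hcoef : ∀ i, inner ℂ (e i) A = a i := by
    intro i
    have h1 : HasSum (fun j ↦ inner ℂ (e i) (a j • e j)) (inner ℂ (e i) A) := hA.mapL (innerSL ℂ (e i))
    have h2 : HasSum (fun j ↦ inner ℂ (e i) (a j • e j)) (a i) := by
      have h3 : (fun j ↦ inner ℂ (e i) (a j • e j)) = fun j ↦ if j = i then a i else 0 := by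
        funext j
        rw [inner_smul_right, orthonormal_iff_ite.1 hON i j]
        split_ifs with h h' h'
        · subst h'; ring
        · exact (h' h.symm).elim
        · exact (h h'.symm).elim
        · ring
      rw [h3]
      exact hasSum_ite_eq i (a i)
    exact h1.unique h2
  have h := hC.mapL (innerSL ℂ A)
  simp only [innerSL_apply_apply, inner_smul_right] at h
  refine h.congr_fun fun i ↦ ?_
  rw [← inner_conj_symm, hcoef, mul_comm]

/-! ## D. (4.4)ᴿ under RH -/

/-- The `ρ`-th term of the `ℓ²` pairing: `conj(b_ρ(t)) b_ρ(u) = π · m_ρ (e^{−iγ_ρt} − 1)(e^{iγ_ρu} − 1)/γ_ρ²`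
under RH (`γ̄_ρ = γ_ρ`). [cite: Suzuki2025WeilHilbertSpace, proof of Thm 4.2 (TeX l.1209–1224)] -/
theorem conj_coeff_mul_coeff (hRH : RiemannHypothesis) (ρ : riemannZetaNontrivialZeros) (t u : ℝ) :
    conj (-((Real.sqrt ((riemannZetaZeroOrder (ρ : ℂ) : ℝ) * Real.pi) : ℝ) : ℂ) *
        (cexp (I * suzukiZeroParam (ρ : ℂ) * t) - 1) / suzukiZeroParam (ρ : ℂ)) *
      (-((Real.sqrt ((riemannZetaZeroOrder (ρ : ℂ) : ℝ) * Real.pi) : ℝ) : ℂ) *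
        (cexp (I * suzukiZeroParam (ρ : ℂ) * u) - 1) / suzukiZeroParam (ρ : ℂ)) =
      (Real.pi : ℂ) * ((riemannZetaZeroOrder (ρ : ℂ) : ℂ) *
        ((cexp (-(I * suzukiZeroParam (ρ : ℂ) * t)) - 1) * (cexp (I * suzukiZeroParam (ρ : ℂ) * u) - 1) /
          suzukiZeroParam (ρ : ℂ) ^ 2)) := by
  have hreal : conj (suzukiZeroParam (ρ : ℂ)) = suzukiZeroParam (ρ : ℂ) :=
    Complex.conj_eq_iff_im.2 (suzukiZeroParam_im_eq_zero hRH ρ.2)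
  have hm0 : (0 : ℝ) ≤ riemannZetaZeroOrder (ρ : ℂ) := ZetaZeroSum.zeroOrder_nonneg ρ
  have hsq : ((Real.sqrt ((riemannZetaZeroOrder (ρ : ℂ) : ℝ) * Real.pi) : ℝ) : ℂ) ^ 2 =
      (riemannZetaZeroOrder (ρ : ℂ) : ℂ) * Real.pi := by
    rw [← Complex.ofReal_pow, Real.sq_sqrt (by positivity)]
    push_cast
    ring
  rw [map_div₀, map_mul, map_neg, Complex.conj_ofReal, map_sub, map_one, ← Complex.exp_conj, map_mul,
    map_mul, Complex.conj_I, Complex.conj_ofReal, hreal]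
  rw [show -I * suzukiZeroParam (ρ : ℂ) * (t : ℂ) = -(I * suzukiZeroParam (ρ : ℂ) * t) by ring]
  linear_combination ((cexp (-(I * suzukiZeroParam (ρ : ℂ) * t)) - 1) *
    (cexp (I * suzukiZeroParam (ρ : ℂ) * u) - 1) / suzukiZeroParam (ρ : ℂ) ^ 2) * hsq

/-- **CJM (4.4), repaired, under RH: `∫_ℝ 𝔖ᴿ_t(x) conj 𝔖ᴿ_u(x) dx = π G_g(t,u)` for all real `t, u`.**
Printed proof followed: the `L²` expansions of `conj 𝔖ᴿ_t`, `conj 𝔖ᴿ_u` in the orthonormal family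
`{[F_γ]}` (Prop 4.1) turn the integral into the `ℓ²` pairing `π Σ_γ m_γ(e^{−iγt} − 1)(e^{iγu} − 1)/γ²`,
which is `π G_g(t,u)` by (4.9). RH-CONSEQUENCE.
[cite: Suzuki2025WeilHilbertSpace, Thm 4.2 eq. (4.4) and its proof (TeX l.1182–1240)] -/
theorem integral_screwLineR_mul_conj (hRH : RiemannHypothesis) (t u : ℝ) :
    ∫ x : ℝ, screwLineR t x * conj (screwLineR u x) = (Real.pi : ℂ) * zetaScrewKernel t u := by
  obtain ⟨⟨hF, hON, -⟩, -, -⟩ := Suzuki2025_prop41_holds hRH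
  obtain ⟨Ct, hCt, haet⟩ := exists_hasSum_coeff_smul_toLp hRH hON t
  obtain ⟨Cu, hCu, haeu⟩ := exists_hasSum_coeff_smul_toLp hRH hON u
  have hinner : inner ℂ Ct Cu = (Real.pi : ℂ) * zetaScrewKernel t u := by
    have h := hasSum_conj_mul_inner_of_hasSum_smul hON hCt hCu
    have h2 := (hasSum_zetaScrewKernel t u).mul_left (Real.pi : ℂ)
    refine h.unique (h2.congr_fun fun ρ ↦ ?_)
    exact conj_coeff_mul_coeff hRH ρ t u
  rw [← hinner, inner_L2_eq_integral]
  refine integral_congr_ae ?_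
  filter_upwards [haet, haeu] with x h1 h2
  rw [h1, h2, Complex.conj_conj]

/-- The `L²(ℝ)` inner product of the classes: `⟪[𝔖ᴿ_a], [𝔖ᴿ_b]⟫ = π G_g(a,b)` under RH (Mathlib's inner
product is conjugate-linear in the first slot; `G_g` is real symmetric). RH-CONSEQUENCE.
[cite: Suzuki2025WeilHilbertSpace, Thm 4.2 eq. (4.4) (TeX l.1182–1194)] -/
theorem inner_toLp_screwLineR (hRH : RiemannHypothesis) (a b : ℝ) :
    inner ℂ ((memLp_screwLineR a).toLp _ : Lp ℂ 2 (volume : Measure ℝ))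
      ((memLp_screwLineR b).toLp _ : Lp ℂ 2 (volume : Measure ℝ)) = (Real.pi : ℂ) * zetaScrewKernel a b := by
  rw [inner_L2_eq_integral, zetaScrewKernel_comm, ← integral_screwLineR_mul_conj hRH b a]
  refine integral_congr_ae ?_
  filter_upwards [MemLp.coeFn_toLp (memLp_screwLineR a), MemLp.coeFn_toLp (memLp_screwLineR b)]
    with x h1 h2
  rw [h1, h2, mul_comm]

end ScrewLineThm42

open ScrewLineThm42

/-! ## E. The discharges -/

/-- **Discharge of `Suzuki2025_thm42R` (CJM Thm 4.2 over the repaired screw line, erratum E21)**: under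
RH, (4.4)ᴿ `(1/π)⟨𝔖ᴿ_t, 𝔖ᴿ_u⟩_{L²(ℝ)} = G_g(t,u)` for all real `t, u`, and `t ↦ π^{−1/2}[𝔖ᴿ_t]` is a
Kreĭn–Langer screw line of `g_ξ` in `L²(ℝ)`: continuity from `‖x(s) − x(t)‖² = G(s,s) − 2G(s,t) + G(t,t)`
and `continuous_zetaScrew`; the screw-line identity from (4.4)ᴿ and
`G_g(t,u) = g(t−u) − g(t) − g(−u) + g(0)`. RH-CONSEQUENCE (explicit binder), PROVED.
[cite: Suzuki2025WeilHilbertSpace, Thm 4.2 (TeX l.1182–1194) and its proof (l.1196–1240); erratum E21] -/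
theorem Suzuki2025_thm42R_holds : Suzuki2025_thm42R := by
  intro hRH
  have h44 : ∀ t u : ℝ, (1 / Real.pi : ℂ) * ∫ x : ℝ, screwLineR t x * conj (screwLineR u x) =
      (zetaScrewKernel t u : ℂ) := by
    intro t u
    rw [integral_screwLineR_mul_conj hRH t u]
    have hπ : (Real.pi : ℂ) ≠ 0 := Complex.ofReal_ne_zero.2 Real.pi_ne_zero
    field_simp
  refine ⟨h44, ?_⟩
  -- the curve `x(t) = π^{−1/2}[𝔖ᴿ_t]` and its Gram kernel
  set x : ℝ → Lp ℂ 2 (volume : Measure ℝ) := fun t ↦ ((Real.sqrt Real.pi)⁻¹ : ℂ) •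
    ((memLp_screwLineR t).toLp _ : Lp ℂ 2 (volume : Measure ℝ)) with hx
  have hG : ∀ a b : ℝ, inner ℂ (x a) (x b) = (zetaScrewKernel a b : ℂ) := by
    intro a b
    rw [hx]
    simp only
    rw [inner_smul_left, inner_smul_right, inner_toLp_screwLineR hRH a b]
    have hπ : (Real.pi : ℂ) ≠ 0 := Complex.ofReal_ne_zero.2 Real.pi_ne_zero
    have hs : ((Real.sqrt Real.pi : ℝ) : ℂ) ≠ 0 :=
      Complex.ofReal_ne_zero.2 (Real.sqrt_ne_zero'.2 Real.pi_pos)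
    have hss : ((Real.sqrt Real.pi : ℝ) : ℂ) ^ 2 = (Real.pi : ℂ) := by
      rw [sq, ← Complex.ofReal_mul, Real.mul_self_sqrt Real.pi_pos.le]
    rw [map_inv₀, Complex.conj_ofReal]
    field_simp
    rw [hss]
  refine ⟨?_, fun t u v ↦ ?_⟩
  · -- continuity
    rw [continuous_iff_continuousAt]
    intro t
    rw [ContinuousAt, tendsto_iff_norm_sub_tendsto_zero]
    have hsq : ∀ s : ℝ, ‖x s - x t‖ ^ 2 = zetaScrewKernel s s - 2 * zetaScrewKernel s t + zetaScrewKernel t t := by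
      intro s
      rw [@norm_sub_sq ℂ, ← inner_self_eq_norm_sq (𝕜 := ℂ), ← inner_self_eq_norm_sq (𝕜 := ℂ), hG, hG, hG]
      simp only [Complex.ofReal_re, RCLike.re_to_complex]
    have hlim : Tendsto (fun s : ℝ ↦ ‖x s - x t‖ ^ 2) (𝓝 t) (𝓝 0) := by
      simp_rw [hsq]
      have hc1 : Continuous fun s : ℝ ↦ zetaScrewKernel s s := by
        simp only [zetaScrewKernel, sub_self, zetaScrew_zero, sub_zero]
        exact continuous_zetaScrew.add continuous_zetaScrew
      have hc2 : Continuous fun s : ℝ ↦ zetaScrewKernel s t := by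
        simp only [zetaScrewKernel]
        exact (continuous_zetaScrew.add continuous_const).sub
          (continuous_zetaScrew.comp (continuous_id.sub continuous_const))
      have hc : Continuous fun s : ℝ ↦
          zetaScrewKernel s s - 2 * zetaScrewKernel s t + zetaScrewKernel t t :=
        (hc1.sub (continuous_const.mul hc2)).add continuous_const
      have h := hc.tendsto t
      have h0 : zetaScrewKernel t t - 2 * zetaScrewKernel t t + zetaScrewKernel t t = 0 := by ring
      rw [h0] at h
      exact h
    have h2 : Tendsto (fun s : ℝ ↦ Real.sqrt (‖x s - x t‖ ^ 2)) (𝓝 t) (𝓝 (Real.sqrt 0)) :=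
      (Real.continuous_sqrt.tendsto 0).comp hlim
    rw [Real.sqrt_zero] at h2
    refine h2.congr fun s ↦ ?_
    rw [Real.sqrt_sq (norm_nonneg _)]
  · -- the Kreĭn–Langer identity
    rw [inner_sub_left, inner_sub_right, inner_sub_right, hG, hG, hG, hG]
    simp only [zetaScrewKernel]
    push_cast
    rw [show u + v - (t + v) = -(t - u) by ring, zetaScrew_neg, show v - (t + v) = -t by ring,
      zetaScrew_neg, sub_self, zetaScrew_zero, Complex.ofReal_zero]
    ring

/-- **Discharge of `Suzuki2025_cor43` (CJM Cor 4.3), PROVED AS AN EQUIVALENCE**: RH `⟺` (4.6)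
`(1/2π)‖𝔖_t‖² = −g(t)` for all `t ≥ t₀`, some `t₀ ≥ 0`. `⇒`: (4.4)ᴿ at `u = t ≥ 0` (where `𝔖ᴿ_t = 𝔖_t`),
via the cell's `Suzuki2025_cor43_of_thm42R`; `⇐`: the cell's RH-free door `Suzuki2025_cor43_mpr`
(Suzuki JLMS 2023 Thms 1.7/11.1). RH-EQUIVALENT·PRINTED (line 1), neither side asserted.
[cite: Suzuki2025WeilHilbertSpace, Cor 4.3 (TeX l.1250–1268)] -/
theorem Suzuki2025_cor43_holds : Suzuki2025_cor43 :=
  Suzuki2025_cor43_of_thm42R Suzuki2025_thm42R_holds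

end Literature.NumberTheory.LFunctions

end
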